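import Mathlib
import Summits.ValiantsHypothesis.ValiantsHypothesis.Theorems.LiouvilleSarnakAlignedCutRank

/-!
# Route LiouvilleSarnak — crux `LiouvilleCutRank` (stmt-ValiantsHypothesis-14775), line
# `one_scale`: the registered stub `stub_windowEmbedding`

The registered skeleton `Cruxes/LiouvilleCutRank/Lines/one_scale.lean`
(line-writer `linewriter-valiant-liouvmonotone-1-g0`, 2026-08-31) cuts the crux `LiouvilleCutRank`
into a scale transfer (Stubs 1–2) and the open one-scale statement (Stub 3).  This file proves
Stub 2, `stub_windowEmbedding`, with EXACTLY the registered signature (the skeleton closes its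
`sorry` by the term `stub_windowEmbedding` of this namespace):

if the window `s, …, s + 2n₁ - 1 < 2n` of a cut `π : Fin n ⊕ Fin n ≃ Fin (2n)` (row/column word
`w`) contains exactly `n₁` row bits, then for SOME cut `π₁ : Fin n₁ ⊕ Fin n₁ ≃ Fin (2n₁)` — the
INDUCED cut, `(π₁.symm k).isLeft = w (s + k)` — the level-`n₁` Liouville cut matrix
`M_{π₁}(r₁, c₁) = λ(N_{π₁}(r₁, c₁) + 1)` has rank at most that of `M_π`.

Proof (the arithmetic of the tree's `LiouvilleSarnakCutRankWindow.card_le_rank_of_window`, with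
`rank M_{π₁}` in place of a determinant certificate):
* §1 the induced cut `π₁` exists (the window has `n₁` row and `n₁` column positions;
  `Equiv.sumCompl`);
* §2 freeze every bit below the window to `1` and every bit above it to `0`: the resulting global
  number satisfies `N_π + 1 = 2^s (N_{π₁} + 1)`, and `λ(2^s x) = (-1)^s λ(x)`
  (`LiouvilleSarnakAligned.liouville_two_pow_mul`), so `M_π.submatrix ρ γ = (-1)^s • M_{π₁}` for the
  corresponding row/column embeddings `ρ, γ`; hence
  `rank M_{π₁} = rank ((-1)^s • M_π.submatrix ρ γ) ≤ rank (M_π.submatrix ρ γ) ≤ rank M_π`.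

Honest framing: bookkeeping for a registered line of an OPEN crux; the one-scale stub
`stub_rankAtOneScale`, the crux `LiouvilleCutRank` (every `W`; rungs `W ≤ 8` are in the tree),
`DigitalBilinearLiouville` and `AlgebraicSarnak` stay open, and nothing here bears on VP versus VNP.
No definitions.
-/

-- the directory `ValiantsHypothesis/ValiantsHypothesis` repeats the summit name (tree layout)
set_option linter.dupNamespace false

namespace Summit.ValiantsHypothesis.ValiantsHypothesis.Theorems.LiouvilleSarnakLiouvilleCutRank.OneScale

open ArithmeticFunction

open Summit.ValiantsHypothesis.ValiantsHypothesis.Theorems.LiouvilleSarnakAligned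
  (liouville_two_pow_mul)

/-! ### §1 The induced cut of a balanced window -/

open scoped Count in
/-- **Induced cut.**  If `w (s + k) = true` for exactly `n₁` of the `k < 2n₁`, there is a cut
`π₁ : Fin n₁ ⊕ Fin n₁ ≃ Fin (2n₁)` whose row positions are exactly those `k`:
`(π₁.symm k).isLeft = w (s + k)`. [folklore] -/
theorem exists_inducedCut (n₁ s : ℕ) (w : ℕ → Bool)
    (hcount : Nat.count (fun k => w (s + k) = true) (2 * n₁) = n₁) :
    ∃ π₁ : Fin n₁ ⊕ Fin n₁ ≃ Fin (2 * n₁), ∀ k : Fin (2 * n₁), (π₁.symm k).isLeft = w (s + k) := by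
  classical
  have hA : Fintype.card {k : Fin (2 * n₁) // w (s + k) = true} = n₁ := by
    have h := hcount
    rw [Nat.count_eq_card_fintype] at h
    refine Eq.trans ?_ h
    exact Fintype.card_congr
      ⟨fun x => ⟨x.1, x.1.2, x.2⟩, fun x => ⟨⟨x.1, x.2.1⟩, x.2.2⟩, fun _ => rfl, fun _ => rfl⟩
  have hB : Fintype.card {k : Fin (2 * n₁) // ¬ w (s + k) = true} = n₁ := by
    rw [Fintype.card_subtype_compl, hA, Fintype.card_fin]
    omega
  refine ⟨((Fintype.equivFinOfCardEq hA).symm.sumCongr (Fintype.equivFinOfCardEq hB).symm).trans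
    (Equiv.sumCompl fun k : Fin (2 * n₁) => w (s + k) = true), fun k => ?_⟩
  by_cases hk : w (s + k) = true
  · rw [Equiv.symm_trans_apply,
      Equiv.sumCompl_symm_apply_of_pos (p := fun k : Fin (2 * n₁) => w (s + k) = true) hk,
      Equiv.sumCongr_symm, Equiv.sumCongr_apply, Sum.isLeft_map, hk]
    rfl
  · rw [Equiv.symm_trans_apply,
      Equiv.sumCompl_symm_apply_of_neg (p := fun k : Fin (2 * n₁) => w (s + k) = true) hk,
      Equiv.sumCongr_symm, Equiv.sumCongr_apply, Sum.isLeft_map, Bool.eq_false_iff.mpr hk]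
    rfl

/-! ### §2 The window embedding -/

/-- **Window embedding for the induced cut.**  Let `s + 2n₁ ≤ 2n`, `w` the row/column word of the
cut `π` on the window `s, …, s + 2n₁ - 1`, and `π₁` a level-`n₁` cut with
`(π₁.symm k).isLeft = w (s + k)`.  Then `rank M_{π₁} ≤ rank M_π`: with the bits below the window
frozen to `1` and those above frozen to `0`, `N_π + 1 = 2^s (N_{π₁} + 1)` and
`λ(2^s x) = (-1)^s λ(x)`, so `(-1)^s M_{π₁}` is a submatrix of `M_π`. [folklore] -/
theorem rank_inducedCut_le (n₁ n : ℕ) (π : Fin n ⊕ Fin n ≃ Fin (2 * n)) (w : ℕ → Bool)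
    (s : ℕ) (hs : s + 2 * n₁ ≤ 2 * n)
    (hw : ∀ j : Fin (2 * n), s ≤ (j : ℕ) → (j : ℕ) < s + 2 * n₁ → w j = (π.symm j).isLeft)
    (π₁ : Fin n₁ ⊕ Fin n₁ ≃ Fin (2 * n₁)) (hπ₁ : ∀ k : Fin (2 * n₁), (π₁.symm k).isLeft = w (s + k)) :
    (Matrix.of fun r c : Fin n₁ → Bool =>
        (((liouville (Nat.ofBits (fun j : Fin (2 * n₁) => Sum.elim r c (π₁.symm j)) + 1) : ℤ) :
          ℂ))).rank ≤
      (Matrix.of fun r c : Fin n → Bool =>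
        (((liouville (Nat.ofBits (fun j : Fin (2 * n) => Sum.elim r c (π.symm j)) + 1) : ℤ) :
          ℂ))).rank := by
  classical
  set M₁ : Matrix (Fin n₁ → Bool) (Fin n₁ → Bool) ℂ := Matrix.of fun r c : Fin n₁ → Bool =>
      (((liouville (Nat.ofBits (fun j : Fin (2 * n₁) => Sum.elim r c (π₁.symm j)) + 1) : ℤ) : ℂ))
    with hM₁
  set M : Matrix (Fin n → Bool) (Fin n → Bool) ℂ := Matrix.of fun r c : Fin n → Bool =>
      (((liouville (Nat.ofBits (fun j : Fin (2 * n) => Sum.elim r c (π.symm j)) + 1) : ℤ) : ℂ))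
    with hM
  -- extension of a local window stream to all positions: ones below the window, zeros above it
  let ext : (ℕ → Bool) → ℕ → Bool := fun z j =>
    if j < s then true else if j < s + 2 * n₁ then z (j - s) else false
  -- local streams of a level-`n₁` row / column assignment, and the merged stream
  let xr : (Fin n₁ → Bool) → ℕ → Bool := fun r₁ k =>
    if h : k < 2 * n₁ then Sum.elim r₁ (fun _ => false) (π₁.symm ⟨k, h⟩) else false
  let yc : (Fin n₁ → Bool) → ℕ → Bool := fun c₁ k =>
    if h : k < 2 * n₁ then Sum.elim (fun _ => false) c₁ (π₁.symm ⟨k, h⟩) else false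
  let z : (Fin n₁ → Bool) → (Fin n₁ → Bool) → ℕ → Bool := fun r₁ c₁ k =>
    if h : k < 2 * n₁ then Sum.elim r₁ c₁ (π₁.symm ⟨k, h⟩) else false
  -- the row / column embeddings
  let ρ : (Fin n₁ → Bool) → (Fin n → Bool) := fun r₁ i => ext (xr r₁) (π (Sum.inl i))
  let γ : (Fin n₁ → Bool) → (Fin n → Bool) := fun c₁ i => ext (yc c₁) (π (Sum.inr i))
  -- (0) on a row position of the window the merged stream is the row stream, and dually
  have hzr : ∀ r₁ c₁ (k : ℕ) (hk : k < 2 * n₁), (π₁.symm ⟨k, hk⟩).isLeft = true →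
      z r₁ c₁ k = xr r₁ k := by
    intro r₁ c₁ k hk hl
    simp only [z, xr, dif_pos hk]
    rcases hq : π₁.symm ⟨k, hk⟩ with i | i
    · rfl
    · rw [hq, Sum.isLeft_inr] at hl
      exact absurd hl (by decide)
  have hzc : ∀ r₁ c₁ (k : ℕ) (hk : k < 2 * n₁), (π₁.symm ⟨k, hk⟩).isLeft = false →
      z r₁ c₁ k = yc c₁ k := by
    intro r₁ c₁ k hk hl
    simp only [z, yc, dif_pos hk]
    rcases hq : π₁.symm ⟨k, hk⟩ with i | i
    · rw [hq, Sum.isLeft_inl] at hl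
      exact absurd hl (by decide)
    · rfl
  -- (1) the global bit vector at `(ρ r₁, γ c₁)` is the extension of the merged local stream
  have hglob : ∀ r₁ c₁ (j : Fin (2 * n)), Sum.elim (ρ r₁) (γ c₁) (π.symm j) = ext (z r₁ c₁) j := by
    intro r₁ c₁ j
    rcases hj : π.symm j with i | i
    · have hji : π (Sum.inl i) = j := by rw [← hj, Equiv.apply_symm_apply]
      rw [Sum.elim_inl]
      show ext (xr r₁) (π (Sum.inl i)) = ext (z r₁ c₁) j
      rw [hji]
      by_cases h1 : (j : ℕ) < s
      · simp [ext, h1]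
      · by_cases h2 : (j : ℕ) < s + 2 * n₁
        · have hk : (j : ℕ) - s < 2 * n₁ := by omega
          have hl : (π₁.symm ⟨(j : ℕ) - s, hk⟩).isLeft = true := by
            rw [hπ₁, show s + ((j : ℕ) - s) = (j : ℕ) by omega, hw j (not_lt.mp h1) h2, hj,
              Sum.isLeft_inl]
          simp [ext, h1, h2, hzr r₁ c₁ _ hk hl]
        · simp [ext, h1, h2]
    · have hji : π (Sum.inr i) = j := by rw [← hj, Equiv.apply_symm_apply]
      rw [Sum.elim_inr]
      show ext (yc c₁) (π (Sum.inr i)) = ext (z r₁ c₁) j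
      rw [hji]
      by_cases h1 : (j : ℕ) < s
      · simp [ext, h1]
      · by_cases h2 : (j : ℕ) < s + 2 * n₁
        · have hk : (j : ℕ) - s < 2 * n₁ := by omega
          have hl : (π₁.symm ⟨(j : ℕ) - s, hk⟩).isLeft = false := by
            rw [hπ₁, show s + ((j : ℕ) - s) = (j : ℕ) by omega, hw j (not_lt.mp h1) h2, hj,
              Sum.isLeft_inr]
          simp [ext, h1, h2, hzc r₁ c₁ _ hk hl]
        · simp [ext, h1, h2]
  -- (2) the number with extended bits: `N + 1 = 2^s (N₁ + 1)`
  have hext : ∀ zz : ℕ → Bool,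
      Nat.ofBits (fun j : Fin (2 * n) => ext zz j) + 1 =
        2 ^ s * (Nat.ofBits (fun k : Fin (2 * n₁) => zz k) + 1) := by
    intro zz
    have h1 : Nat.ofBits (fun j : Fin (2 * n) => ext zz j) =
        2 ^ s * Nat.ofBits (fun k : Fin (2 * n₁) => zz k) + (2 ^ s - 1) := by
      apply Nat.eq_of_testBit_eq
      intro i
      rw [Nat.testBit_ofBits,
        Nat.testBit_two_pow_mul_add _ (Nat.sub_lt (Nat.two_pow_pos s) Nat.one_pos),
        Nat.testBit_two_pow_sub_one, Nat.testBit_ofBits]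
      simp only [ext]
      split_ifs <;> simp_all <;> omega
    rw [h1, Nat.mul_add, mul_one, Nat.add_assoc, Nat.sub_add_cancel Nat.one_le_two_pow]
  -- (3) the local number of the merged stream is `N_{π₁}(r₁, c₁)`
  have hloc : ∀ r₁ c₁, (fun k : Fin (2 * n₁) => z r₁ c₁ k) =
      fun k : Fin (2 * n₁) => Sum.elim r₁ c₁ (π₁.symm k) := by
    intro r₁ c₁
    funext k
    simp [z, k.isLt]
  -- (4) entries of the submatrix
  have hentry : ∀ r₁ c₁, M (ρ r₁) (γ c₁) = (-1 : ℂ) ^ s * M₁ r₁ c₁ := by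
    intro r₁ c₁
    have hfun : (fun j : Fin (2 * n) => Sum.elim (ρ r₁) (γ c₁) (π.symm j)) =
        fun j : Fin (2 * n) => ext (z r₁ c₁) j := funext (hglob r₁ c₁)
    have hN : Nat.ofBits (fun j : Fin (2 * n) => Sum.elim (ρ r₁) (γ c₁) (π.symm j)) + 1 =
        2 ^ s * (Nat.ofBits (fun k : Fin (2 * n₁) => Sum.elim r₁ c₁ (π₁.symm k)) + 1) := by
      rw [hfun, hext (z r₁ c₁), hloc r₁ c₁]
    simp only [hM, hM₁, Matrix.of_apply]
    rw [hN, liouville_two_pow_mul]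
    push_cast
    ring
  -- (5) the submatrix is `(-1)^s • M₁`, so `M₁ = (-1)^s • submatrix`
  have hsub : M.submatrix ρ γ = ((-1 : ℂ) ^ s) • M₁ := by
    ext r₁ c₁
    simp only [Matrix.submatrix_apply, Matrix.smul_apply, smul_eq_mul]
    exact hentry r₁ c₁
  have hM₁eq : M₁ = ((-1 : ℂ) ^ s) • M.submatrix ρ γ := by
    rw [hsub, smul_smul, ← mul_pow, neg_one_mul, neg_neg, one_pow, one_smul]
  calc M₁.rank = (((-1 : ℂ) ^ s) • M.submatrix ρ γ).rank := by rw [← hM₁eq]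
    _ = (Matrix.diagonal (fun _ : Fin n₁ → Bool => (-1 : ℂ) ^ s) * M.submatrix ρ γ).rank := by
        rw [Matrix.smul_eq_diagonal_mul]
    _ ≤ (M.submatrix ρ γ).rank := Matrix.rank_mul_le_right _ _
    _ ≤ M.rank := Matrix.rank_submatrix_le M ρ γ

/-! ### §3 The registered stub -/

/-- **Stub `stub_windowEmbedding` of line `one_scale` (crux `LiouvilleCutRank`,
stmt-ValiantsHypothesis-14775), PROVED — exactly the registered signature.**  If the window
`s, …, s + 2n₁ - 1 < 2n` of the cut `π` (row/column word `w`) contains exactly `n₁` row bits, then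
for some (the induced) cut `π₁` at level `n₁` the Liouville cut matrix `M_{π₁}` has rank at most
`rank M_π` (§1 induced cut, §2 window embedding). [folklore] -/
theorem stub_windowEmbedding :
    ∀ n₁ n : ℕ, ∀ (π : Fin n ⊕ Fin n ≃ Fin (2 * n)) (w : ℕ → Bool),
      (∀ j : Fin (2 * n), w j = (π.symm j).isLeft) →
      ∀ s : ℕ, s + 2 * n₁ ≤ 2 * n → Nat.count (fun k => w (s + k) = true) (2 * n₁) = n₁ →
      ∃ π₁ : Fin n₁ ⊕ Fin n₁ ≃ Fin (2 * n₁),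
        (Matrix.of fun r c : Fin n₁ → Bool =>
          (((ArithmeticFunction.liouville
            (Nat.ofBits (fun j : Fin (2 * n₁) => Sum.elim r c (π₁.symm j)) + 1) : ℤ) : ℂ))).rank ≤
        (Matrix.of fun r c : Fin n → Bool =>
          (((ArithmeticFunction.liouville
            (Nat.ofBits (fun j : Fin (2 * n) => Sum.elim r c (π.symm j)) + 1) : ℤ) : ℂ))).rank := by
  intro n₁ n π w hw s hs hcount
  obtain ⟨π₁, hπ₁⟩ := exists_inducedCut n₁ s w hcount
  exact ⟨π₁, rank_inducedCut_le n₁ n π w s hs (fun j _ _ => hw j) π₁ hπ₁⟩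

end Summit.ValiantsHypothesis.ValiantsHypothesis.Theorems.LiouvilleSarnakLiouvilleCutRank.OneScale
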